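import Mathlib
import Summits.AtomisticToContinuum.HydrodynamicLimit.Theorems.ImplosionDichotomyDenseExcursionR2Modes

/-!
# The scaling symmetry mode `Λ = 0` of `SS(r₂)` — stub `stub_scalingMode` (line `r2-one-mode-two-conditions`, v8d)

Crux `Summit.AtomisticToContinuum.HydrodynamicLimit.Theses.ImplosionDichotomy.DenseExcursion`
(stmt-AtomisticToContinuum-12586), skeleton v8d of the line `r2-one-mode-two-conditions`, registered stub
`stub_scalingMode : ScalingMode` (definition `ScalingMode` verbatim from the skeleton, §0e; `IsMonatomicProfile`,
`IsRegularPair`, `IsSmoothRadialMode`, `linW`, `linS` are the landed ones of `…R2Profile.lean`, `…R2Modes.lean`).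

**Statement.** For every monatomic profile `IsMonatomicProfile r W S` satisfying the radial momentum and mass
equations in original form `(W-1)W' + 3SS' = rW - W² - 3S²`, `(1-W)S' - (S/3)W' = S(2W - r)` everywhere, the
`x`-translation generator `(ŵ, ŝ) = (W', S')` (space scaling `R ↦ λR` in the original variables) is a smooth
centre-regular radial mode of the typed linearised operator `(linW, linS)` with eigenvalue `Λ = 0`.

**Proof.**
* Eigen-identities (`lin_scaling_mode`): `linW r W S W' S' = 0`, `linS r W S W' S' = 0` are exactly the two
  profile equations differentiated once (`profileEqs_deriv` of `…R2Modes.lean`) after `push_cast` — the algebra of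
  the disprover's certified `R2Line.lin_translation_mode` (Cruxes work file `DenseExcursion/Disproof.lean` §12).
* Centre regularity: with the smooth extensions `F`, `G` of `W(log ‖y‖) y`, `‖y‖ S(log ‖y‖)` packaged in
  `IsMonatomicProfile`, Euler's identity along rays (`fderiv_apply_self_of_radialField`,
  `fderiv_apply_self_of_radialScalar` of `…R2Modes.lean`) gives `W'(log ‖y‖) y = F'(y)y - F y` and
  `‖y‖ S'(log ‖y‖) = G'(y)y - G y` off the origin, and `y ↦ F'(y)y - F y`, `y ↦ G'(y)y - G y` are `C^∞` on `ℝ³`;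
  the imaginary parts vanish (the mode is real).
* Non-triviality (`exists_deriv_ne_zero`): if `W' ≡ 0` and `S' ≡ 0` then `W` is constant, hence `≡ 0` by the
  far-field condition `W → 0`, and the mass equation at `x = 0` reads `0 = -r S(0)` with `S(0) > 0`, `r > 1`.
Folklore one-variable calculus; no cited facts.
-/

noncomputable section

open Set Filter Topology
open scoped ContDiff

namespace Summit.AtomisticToContinuum.HydrodynamicLimit.Theorems.R2OneModeTwoConditions

open Literature.MathematicalPhysics.KineticTheory (V3)

/-! ## The line-posited definition (verbatim: skeleton `r2-one-mode-two-conditions` v8d, §0e) -/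

/-- THE SCALING SYMMETRY MODE IS A SMOOTH RADIAL MODE AT `Λ = 0`: for every monatomic profile with its original-form equations,
`(W′, S′)` (the `x`-translation = space-scaling generator) satisfies `IsSmoothRadialMode r W S 0 W′ S′` — eigen-identities =
the differentiated profile equations (`profileEqs_deriv`; cf. the disprover's certified `linW_translation_mode`), centre regularity
from that of the profile (`W′(log‖y‖) y = DF(y) y − F y`, `‖y‖ S′ = DG(y) y − G y`), non-triviality since `W` is not constant. -/
def ScalingMode : Prop :=
  ∀ (r : ℝ) (W S : ℝ → ℝ), IsMonatomicProfile r W S →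
    (∀ x, (W x - 1) * deriv W x + 3 * S x * deriv S x = r * W x - W x ^ 2 - 3 * S x ^ 2 ∧
      (1 - W x) * deriv S x - S x / 3 * deriv W x = S x * (2 * W x - r)) →
    IsSmoothRadialMode r W S 0 (fun x => ((deriv W x : ℝ) : ℂ)) (fun x => ((deriv S x : ℝ) : ℂ))

/-! ## The eigen-identities at `Λ = 0`, non-triviality, and the stub -/

-- adapted from Cruxes/DenseExcursion/Disproof.lean §12 (`R2Line.lin_translation_mode`; `C^∞` hypotheses)
/-- **SCALING MODE `Λ = 0`, THE EIGEN-IDENTITIES**: for `C^∞` profiles satisfying the two profile equations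
everywhere, `(ŵ, ŝ) = (W', S')` is annihilated by the typed operator: `linW = 0`, `linS = 0` (`x`-translation
invariance of the autonomous profile system; the two profile equations differentiated once). [folklore] -/
theorem lin_scaling_mode {r : ℝ} {W S : ℝ → ℝ} (hW : ContDiff ℝ ∞ W) (hS : ContDiff ℝ ∞ S)
    (hM : ∀ x, (W x - 1) * deriv W x + 3 * S x * deriv S x = r * W x - W x ^ 2 - 3 * S x ^ 2)
    (hC : ∀ x, (1 - W x) * deriv S x - S x / 3 * deriv W x = S x * (2 * W x - r)) (x : ℝ) :
    linW r W S (fun y => ((deriv W y : ℝ) : ℂ)) (fun y => ((deriv S y : ℝ) : ℂ)) x = 0 ∧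
    linS r W S (fun y => ((deriv W y : ℝ) : ℂ)) (fun y => ((deriv S y : ℝ) : ℂ)) x = 0 := by
  have hW2 : Differentiable ℝ (deriv W) := (contDiff_infty_iff_deriv.1 hW).2.differentiable (by simp)
  have hS2 : Differentiable ℝ (deriv S) := (contDiff_infty_iff_deriv.1 hS).2.differentiable (by simp)
  obtain ⟨dM, dC⟩ := profileEqs_deriv hW hS hM hC x
  have dŵ : deriv (fun y => ((deriv W y : ℝ) : ℂ)) x = ((deriv (deriv W) x : ℝ) : ℂ) :=
    ((hW2 x).hasDerivAt.ofReal_comp).deriv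
  have dŝ : deriv (fun y => ((deriv S y : ℝ) : ℂ)) x = ((deriv (deriv S) x : ℝ) : ℂ) :=
    ((hS2 x).hasDerivAt.ofReal_comp).deriv
  have dMc := congrArg (fun t : ℝ => (t : ℂ)) dM
  have dCc := congrArg (fun t : ℝ => (t : ℂ)) dC
  push_cast at dMc dCc
  unfold linW linS
  rw [dŵ, dŝ]
  push_cast
  constructor
  · linear_combination dMc
  · linear_combination (-1 : ℂ) * dCc

/-- NON-TRIVIALITY OF THE SCALING MODE: `(W', S')` does not vanish identically. Otherwise `W` is constant, hence
`W ≡ 0` by the far-field condition `W → 0` at `+∞`, and the mass equation at `x = 0` collapses to `0 = -r S(0)`,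
impossible for `S(0) > 0`, `r > 1`. [folklore] -/
theorem exists_deriv_ne_zero {r : ℝ} {W S : ℝ → ℝ} (hr : 1 < r) (hW : Differentiable ℝ W) (hS0 : 0 < S 0)
    (hWlim : Tendsto W atTop (𝓝 0))
    (hC : ∀ x, (1 - W x) * deriv S x - S x / 3 * deriv W x = S x * (2 * W x - r)) :
    ∃ x, deriv W x ≠ 0 ∨ deriv S x ≠ 0 := by
  by_contra h
  simp only [not_exists, not_or, not_not] at h
  have hconst : ∀ x, W x = W 0 := fun x => is_const_of_deriv_eq_zero hW (fun y => (h y).1) x 0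
  have hW0 : W 0 = 0 :=
    tendsto_nhds_unique (tendsto_const_nhds.congr fun x => (hconst x).symm) hWlim
  have h0 : S 0 * r = 0 := by
    have := hC 0
    rw [(h 0).1, (h 0).2, hW0] at this
    linear_combination this
  have h1 : 0 < S 0 * r := mul_pos hS0 (lt_trans one_pos hr)
  exact h1.ne' h0

/-- **Stub `stub_scalingMode` of line `r2-one-mode-two-conditions` (v8d): THE SCALING SYMMETRY MODE IS A SMOOTH
RADIAL MODE AT `Λ = 0`.** For every monatomic profile `IsMonatomicProfile r W S` with its original-form equations,
`(ŵ, ŝ) = (W', S')` satisfies `IsSmoothRadialMode r W S 0 ŵ ŝ`: `ŵ, ŝ` are `C^∞` (derivatives of `C^∞` maps, cast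
to `ℂ`); centre regularity with the smooth fields `F₁ = F'(y)y - F y`, `G₁ = G'(y)y - G y`, `F₂ = G₂ = 0`
(Euler's identity along rays); non-triviality by `exists_deriv_ne_zero`; eigen-identities by `lin_scaling_mode`.
[folklore] -/
theorem stub_scalingMode : ScalingMode := by
  intro r W S hP hEqs
  obtain ⟨hr1, -, hW, hS, hSpos, -, ⟨F, G, hF, hG, -, hFG⟩, hWlim, -⟩ := hP
  have hW1 : Differentiable ℝ W := hW.differentiable (by simp)
  have hS1 : Differentiable ℝ S := hS.differentiable (by simp)
  have hF1 : Differentiable ℝ F := hF.differentiable (by simp)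
  have hG1 : Differentiable ℝ G := hG.differentiable (by simp)
  refine ⟨⟨?_, ?_, ?_⟩, ?_, ?_⟩
  · -- `ŵ = W'` is smooth
    exact Complex.ofRealCLM.contDiff.comp (contDiff_infty_iff_deriv.1 hW).2
  · -- `ŝ = S'` is smooth
    exact Complex.ofRealCLM.contDiff.comp (contDiff_infty_iff_deriv.1 hS).2
  · -- centre regularity
    refine ⟨fun y => fderiv ℝ F y y - F y, fun _ => 0, fun y => fderiv ℝ G y y - G y, fun _ => 0, ?_,
      contDiff_const, ?_, contDiff_const, ?_⟩
    · exact ((contDiff_infty_iff_fderiv.1 hF).2.clm_apply contDiff_id).sub hF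
    · exact ((contDiff_infty_iff_fderiv.1 hG).2.clm_apply contDiff_id).sub hG
    · intro y hy
      refine ⟨?_, ?_, ?_, ?_⟩
      · dsimp only
        rw [Complex.ofReal_re, fderiv_apply_self_of_radialField hW1 hF1 (fun z hz => (hFG z hz).1) hy]
        abel
      · rw [Complex.ofReal_im, zero_smul]
      · dsimp only
        rw [Complex.ofReal_re, fderiv_apply_self_of_radialScalar hS1 hG1 (fun z hz => (hFG z hz).2) hy]
        ring
      · rw [Complex.ofReal_im, mul_zero]
  · -- non-triviality: `(W', S') ≢ 0`
    obtain ⟨x, hx⟩ := exists_deriv_ne_zero hr1 hW1 (hSpos 0) hWlim fun z => (hEqs z).2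
    exact ⟨x, hx.imp Complex.ofReal_ne_zero.2 Complex.ofReal_ne_zero.2⟩
  · -- the eigen-identities at `Λ = 0`
    intro x
    obtain ⟨h1, h2⟩ := lin_scaling_mode hW hS (fun z => (hEqs z).1) (fun z => (hEqs z).2) x
    constructor
    · rw [zero_mul]; exact h1.symm
    · rw [zero_mul]; exact h2.symm

end Summit.AtomisticToContinuum.HydrodynamicLimit.Theorems.R2OneModeTwoConditions

end
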